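import Mathlib

/-!
# `SnSubsetDichotomy.ThresholdSubsetTriples`, line `SketchIdeator6` (genus / Riemann–Hurwitz certificate) — stub `stub_rh`

Registered stub `stub_rh` of the lead skeleton (crux `stmt-MatrixMultiplication-10882`).
Riemann–Hurwitz inequality `cyc σ + cyc τ + cyc (στ) ≤ |α| + 2·orb⟨σ,τ⟩` for all finite types, from the Walkup step by `Fintype.induction_empty_option`.
-/

namespace Summit.MatrixMultiplication.MatrixMultiplication.Theorems.ThresholdSubsetTriples

/-- Conjugating a permutation group along `e : α ≃ β` does not change its number of orbits. -/
private theorem rh_card_orbquot_map {α β : Type} (e : α ≃ β) (G : Subgroup (Equiv.Perm α))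
    (H : Subgroup (Equiv.Perm β)) (hH : H = G.map e.permCongrHom.toMonoidHom) :
    Nat.card (MulAction.orbitRel.Quotient H β) = Nat.card (MulAction.orbitRel.Quotient G α) := by
  subst hH
  refine Nat.card_congr (Quotient.congr e.symm fun b₁ b₂ => ?_)
  rw [MulAction.orbitRel_apply, MulAction.orbitRel_apply, MulAction.mem_orbit_iff,
    MulAction.mem_orbit_iff]
  constructor
  · rintro ⟨⟨g, hg⟩, rfl⟩
    obtain ⟨g₀, hg₀, rfl⟩ := Subgroup.mem_map.mp hg
    exact ⟨⟨g₀, hg₀⟩, (e.symm_apply_apply _).symm⟩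
  · rintro ⟨⟨g₀, hg₀⟩, h⟩
    exact ⟨⟨e.permCongr g₀, Subgroup.mem_map.mpr ⟨g₀, hg₀, rfl⟩⟩,
      (congrArg e h).trans (e.apply_symm_apply b₁)⟩

/-- The cycle count (number of `zpowers`-orbits) is invariant under `Equiv.permCongr`. -/
private theorem rh_cyc_congr {α β : Type} (e : α ≃ β) (π : Equiv.Perm α) :
    Nat.card (MulAction.orbitRel.Quotient (Subgroup.zpowers (e.permCongr π)) β) =
      Nat.card (MulAction.orbitRel.Quotient (Subgroup.zpowers π) α) :=
  rh_card_orbquot_map e _ _ (by rw [MonoidHom.map_zpowers]; rfl)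

/-- The orbit count of a two-generated permutation group is invariant under `Equiv.permCongr`. -/
private theorem rh_orb_congr {α β : Type} (e : α ≃ β) (σ τ : Equiv.Perm α) :
    Nat.card (MulAction.orbitRel.Quotient
        (Subgroup.closure ({e.permCongr σ, e.permCongr τ} : Set (Equiv.Perm β))) β) =
      Nat.card (MulAction.orbitRel.Quotient
        (Subgroup.closure ({σ, τ} : Set (Equiv.Perm α))) α) :=
  rh_card_orbquot_map e _ _ (by rw [MonoidHom.map_closure, Set.image_pair]; rfl)

/-- **Stub `stub_rh`.** Riemann–Hurwitz for permutation pairs (genus of a 3-constellation is non-negative), from the Walkup step. [cite: LandoZvonkin2004, Ch. 1] -/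
theorem stub_rh : (∀ (β : Type) [Fintype β] [DecidableEq β] (σ τ : Equiv.Perm (Option β)), Nat.card (MulAction.orbitRel.Quotient (Subgroup.zpowers σ) (Option β)) + Nat.card (MulAction.orbitRel.Quotient (Subgroup.zpowers τ) (Option β)) + Nat.card (MulAction.orbitRel.Quotient (Subgroup.zpowers (σ * τ)) (Option β)) + 2 * Nat.card (MulAction.orbitRel.Quotient (Subgroup.closure ({Equiv.removeNone σ, Equiv.removeNone τ} : Set (Equiv.Perm β))) (β)) ≤ Nat.card (MulAction.orbitRel.Quotient (Subgroup.zpowers (Equiv.removeNone σ)) (β)) + Nat.card (MulAction.orbitRel.Quotient (Subgroup.zpowers (Equiv.removeNone τ)) (β)) + Nat.card (MulAction.orbitRel.Quotient (Subgroup.zpowers (Equiv.removeNone σ * Equiv.removeNone τ)) (β)) + 1 + 2 * Nat.card (MulAction.orbitRel.Quotient (Subgroup.closure ({σ, τ} : Set (Equiv.Perm (Option β)))) (Option β))) → ∀ (α : Type) [Fintype α] (σ τ : Equiv.Perm α), Nat.card (MulAction.orbitRel.Quotient (Subgroup.zpowers σ) (α)) + Nat.card (MulAction.orbitRel.Quotient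 (Subgroup.zpowers τ) (α)) + Nat.card (MulAction.orbitRel.Quotient (Subgroup.zpowers (σ * τ)) (α)) ≤ Nat.card α + 2 * Nat.card (MulAction.orbitRel.Quotient (Subgroup.closure ({σ, τ} : Set (Equiv.Perm α))) (α)) := by
  intro hW
  apply Fintype.induction_empty_option
  · -- transport along an equivalence
    intro α₁ α₂ _ e ih σ τ
    obtain ⟨σ, rfl⟩ := e.permCongr.surjective σ
    obtain ⟨τ, rfl⟩ := e.permCongr.surjective τ
    rw [← Equiv.permCongr_mul, rh_cyc_congr, rh_cyc_congr, rh_cyc_congr, rh_orb_congr,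
      Nat.card_congr e.symm]
    exact ih σ τ
  · -- the empty type: every orbit quotient is empty
    intro σ τ
    simp
  · -- the `Option` step is the Walkup hypothesis plus the induction hypothesis
    intro β _ ih σ τ
    classical
    have h1 := hW β σ τ
    -- the induction hypothesis, restated in the syntactic form of `hW` (the ambient group of
    -- `Subgroup.zpowers (Equiv.removeNone σ)` is inferred as `β ≃ β` there)
    have h2 : Nat.card (MulAction.orbitRel.Quotient (Subgroup.zpowers (Equiv.removeNone σ)) β) +
        Nat.card (MulAction.orbitRel.Quotient (Subgroup.zpowers (Equiv.removeNone τ)) β) +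
        Nat.card (MulAction.orbitRel.Quotient
          (Subgroup.zpowers (Equiv.removeNone σ * Equiv.removeNone τ)) β) ≤
        Nat.card β + 2 * Nat.card (MulAction.orbitRel.Quotient (Subgroup.closure
          ({Equiv.removeNone σ, Equiv.removeNone τ} : Set (Equiv.Perm β))) β) :=
      ih (Equiv.removeNone σ) (Equiv.removeNone τ)
    have h3 : Nat.card (Option β) = Nat.card β + 1 := Finite.card_option
    omega

end Summit.MatrixMultiplication.MatrixMultiplication.Theorems.ThresholdSubsetTriples
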